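import Summits.PneNP.PneNP.Theorems.PhaseTwinsNoFBPPApproxAboveUniquenessCalibration
import Summits.PneNP.PneNP.Theorems.PhaseTwinsNoFBPPApproxAboveUniquenessFactFree
import Literature.Computability.Complexity.BPClosureProofs
import Literature.Computability.Complexity.CookLevinSAT
import Literature.Computability.Complexity.NegCNFTranscoder

/-!
# The PCP corner of crux stmt-PneNP-2717: the existential crux is witnessed at ONE admissible instance, fact-free

Line `SketchIdeator1` (card `stockmeyer-bpp-calibration`), seat prover-line-stmt-PneNP-2717-c1-0.

The landed fact-free corner (`stub_factFreeAssembly`, `NP_subset_BPP_of_hardcoreFPRAS_everywhere`) consumes an FPRAS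
for `hardcoreCount Δ p q` at EVERY admissible `(Δ, p, q)`, because for each `NP` language it reads off its own
gap-E3SAT-`B` reduction `(g, γ, B)` and runs the FPRAS at the corner `(B+3, 2^K, 1)`, `K = K(γ, B)`. Running the
same argument for the single NP-complete language `SAT` (Cook–Levin, `SAT_isNPHard_holds`, `SAT_mem_NP_holds`, both
proved in the tree) pins ONE admissible corner `(Δ₀, p₀, 1) = (B_SAT + 3, 2^{K_SAT}, 1)`:

* `mem_BPP_of_hasFPRAS_corner` — the single-language form of the assembly: a gap-E3SAT-`B` presentation of `L`
  and an FPRAS at `(B+3, 2^K, 1)` put `L ∈ BPP` (proof = the landed assembly's body, for one `L`);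
* `exists_hardCorner` — **there is an admissible `(Δ₀, p₀, q₀)` at which an FPRAS for the hard-core count alone
  gives `NP ⊆ BPP`** (fact-free `BPP`-hardness of approximate counting at one explicit parameter point; the
  tree's vendored GŠV16 Thm 1 `NP_eq_RP_of_hardcoreFPRAS` asserts this at every admissible point, unproved);
* `noFBPPApproxAboveUniqueness_iff_not_hasFPRAS_corner` (registered sub-goal) — **the crux, an `∃ (Δ, p, q)`
  statement, is EQUIVALENT to its instance at that corner**: `X ↔ ¬ HasFPRAS (hardcoreCount Δ₀ p₀ q₀)`. So the
  existential quantifier of the route's thesis carries no freedom: X is the single membership-type question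
  "no FPRAS for the hard-core count at the PCP corner", equivalently `SAT ∉ BPP`.
-/

set_option linter.dupNamespace false

namespace Summit.PneNP.PneNP.Theorems.NoFBPPApproxAboveUniqueness

open Literature.Computability.Complexity Literature.Probability.LatticeModels
open _root_.Computability Polynomial Brick Finset
open Summit.PneNP.PneNP.Theorems (stub_conflictGraphFn stub_gapE3SATB)
open Summit.PneNP.PneNP.Theses.PhaseTwins (NoFBPPApproxAboveUniqueness)

/-- **One language, one corner.** If `L` has a gap-E3SAT-`B` presentation `g ∈ FP` (YES ↦ satisfiable, NO ↦
`maxSatFraction ≤ 1 - γ`, `γ > 0`, every variable in `≤ B` clauses), `K ≥ B + 3`, `K γ ≥ 6`, and the hard-core count has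
an FPRAS at the admissible corner `(B+3, 2^K, 1)`, then `L ∈ BPP`: the FPRAS-driven one-bit decider
(`stub_fprasDecider`) on the conflict-graph code (`stub_conflictGraphFn`) is correct whenever the estimate is within
a factor `2` (counting window `ConflictGraphGap.window`; `size_ge_of_yes` / `size_lt_of_no`), i.e. with probability
`≥ 3/4`. (The body of the landed `stub_factFreeAssembly`, specialised to one language.)
[cite: Sly2010, §1 (zero-temperature limit)] -/
theorem mem_BPP_of_hasFPRAS_corner {L : Language Bool} {g : List Bool → List Bool} {γ : ℚ} {B K : ℕ}
    (hg : g ∈ FP)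
    (hspec : ∀ y : List Bool, ∃ φ : CNF ℕ, g y = encodingCNF.encode φ ∧ φ.IsExactWidth 3 ∧
      (∀ v : ℕ, (φ.countP fun cl => v ∈ cl.map Prod.fst) ≤ B) ∧
      (y ∈ L → φ.Satisfiable) ∧ (y ∉ L → φ.maxSatFraction ≤ 1 - γ))
    (hγ : 0 < γ) (hKB : B + 3 ≤ K) (hK6 : (6 : ℚ) ≤ K * γ)
    (hFP : HasFPRAS (hardcoreCount (B + 3) (2 ^ K) 1)) : L ∈ BPP := by
  have hK3 : 3 ≤ K := by omega
  obtain ⟨F, hF, c, hc⟩ := hFP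
  -- the conflict-graph code map and the decider
  obtain ⟨f, hf, hfspec⟩ := stub_conflictGraphFn
  obtain ⟨D, hD, hD1, hDval⟩ :=
    stub_fprasDecider (comp_mem_FP hf hg) (comp_mem_FP fstF_mem_FP hg) hF c K
  obtain ⟨s, hs⟩ := exists_poly_length_le_of_mem_FP (comp_mem_FP hf hg)
  -- `L ∈ bp P`
  refine ⟨{w | D w = [true]}, ?_, c.comp (s + 5), fun y => ?_⟩
  · exact mem_P_of_mem_FP hD _ fun w => ⟨fun h => h, fun h => (hD1 w).resolve_left h⟩
  -- the instance
  obtain ⟨φ, hgy, h3, hBocc, hyes, hno⟩ := hspec y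
  set x := (f ∘ g) y with hx
  set Gc : SimpleGraph (Fin (KarpClique.annot 0 φ).length) :=
    SimpleGraph.fromRel fun p q : Fin (KarpClique.annot 0 φ).length =>
      ((KarpClique.annot 0 φ)[p].1 = (KarpClique.annot 0 φ)[q].1 ∧
          (KarpClique.annot 0 φ)[p].2.1 ≠ (KarpClique.annot 0 φ)[q].2.1) ∨
      ((KarpClique.annot 0 φ)[p].2.1 = (KarpClique.annot 0 φ)[q].2.1 ∧
          (KarpClique.annot 0 φ)[p].2.2 ≠ (KarpClique.annot 0 φ)[q].2.2) with hGc
  have hxcode : x = encodingGraph.encode ⟨(KarpClique.annot 0 φ).length, Gc⟩ := by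
    rw [hx, Function.comp_apply, hgy, hfspec φ]
  have hadj : ∀ p q : Fin (KarpClique.annot 0 φ).length, Gc.Adj p q ↔ p ≠ q ∧
      (((KarpClique.annot 0 φ)[p].1 = (KarpClique.annot 0 φ)[q].1 ∧
          (KarpClique.annot 0 φ)[p].2.1 ≠ (KarpClique.annot 0 φ)[q].2.1) ∨
        ((KarpClique.annot 0 φ)[p].2.1 = (KarpClique.annot 0 φ)[q].2.1 ∧
          (KarpClique.annot 0 φ)[p].2.2 ≠ (KarpClique.annot 0 φ)[q].2.2)) := by
    intro p q
    rw [hGc, SimpleGraph.fromRel_adj]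
    refine and_congr_right fun _ => ⟨fun h => h.elim id fun h' => ?_, Or.inl⟩
    exact h'.elim (fun h1 => Or.inl ⟨h1.1.symm, fun e => h1.2 e.symm⟩)
      (fun h1 => Or.inr ⟨h1.1.symm, fun e => h1.2 e.symm⟩)
  have hwin := ConflictGraphGap.window B γ K hK6 hK3 φ h3 hBocc
  -- names
  set m := φ.length with hm
  set N := hardcoreCount (B + 3) (2 ^ K) 1 x with hN
  set ℓ := c.eval (x.length + 1 + 4) with hℓ
  set T := (c.comp (s + 5)).eval y.length with hT
  have hhdr : ((fstF ∘ g) y).length = m := by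
    rw [Function.comp_apply, hgy, length_fstF_encodingCNF]
  have hℓT : ℓ ≤ T := by
    rw [hℓ, hT, eval_comp, eval_add]
    exact TM2Iter.eval_mono c (by have := hs y; rw [← hx] at this; simp; omega)
  -- the bad event has probability `≤ 1/4`
  have hbad : uniformProb T {u | ¬ IsApproxCount 1 N (countEstimate F x 0 1 4 (u.take ℓ))} ≤ 1 / 4 := by
    have h := hc x 1 4 Nat.one_pos (by norm_num)
    have h' := APTransfer.uniformProb_take_le_of_le hℓT
      {u' | ¬ IsApproxCount 1 N (countEstimate F x 0 1 4 u')} h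
    norm_num at h' ⊢
    exact h'
  -- on the good event the verdict is right
  have hcorrect : ∀ u : List Bool, u.length = T →
      u ∈ ({u | ¬ IsApproxCount 1 N (countEstimate F x 0 1 4 (u.take ℓ))} : Set (List Bool))ᶜ →
        u ∈ {u : List Bool | boolPair y u ∈ ({w | D w = [true]} : Language Bool) ↔ y ∈ L} := by
    intro u _ hgoodu
    have happrox : IsApproxCount 1 N (countEstimate F x 0 1 4 (u.take ℓ)) := by
      simpa using hgoodu
    show D (boolPair y u) = [true] ↔ y ∈ L
    rw [hDval y u, hhdr, HamNP.singleton_decide_eq_true_iff, TM2Pass.length_encodeNat_eq_size]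
    change K * m ≤ Nat.size (countEstimate F x 0 1 4 (u.take ℓ)) ↔ y ∈ L
    by_cases hy : y ∈ L
    · simp only [hy, iff_true]
      rcases Nat.eq_zero_or_pos m with hm0 | hmpos
      · rw [hm0, Nat.mul_zero]; exact Nat.zero_le _
      · have hyes' := (hwin hmpos Gc hadj).1 (hyes hy)
        rw [← hxcode] at hyes'
        exact size_ge_of_yes (le_trans hK3 (Nat.le_mul_of_pos_right K hmpos)) hyes' happrox
    · simp only [hy, iff_false, not_le]
      have hmpos : 0 < m := by
        rcases Nat.eq_zero_or_pos m with hm0 | hmpos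
        · exfalso
          have hφ : φ = [] := List.eq_nil_of_length_eq_zero (by rw [← hm]; exact hm0)
          have := hno hy
          rw [hφ, CNF.maxSatFraction_nil] at this
          linarith
        · exact hmpos
      obtain ⟨-, hNle⟩ := (hwin hmpos Gc hadj).2 (hno hy)
      rw [← hxcode] at hNle
      exact size_lt_of_no (le_trans hK3 (Nat.le_mul_of_pos_right K hmpos)) hNle happrox
  -- probability bookkeeping
  have hcompl := uniformProb_compl T {u | ¬ IsApproxCount 1 N (countEstimate F x 0 1 4 (u.take ℓ))}
  calc (2 : ℝ) / 3 ≤ 1 - 1 / 4 := by norm_num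
    _ ≤ 1 - uniformProb T {u | ¬ IsApproxCount 1 N (countEstimate F x 0 1 4 (u.take ℓ))} := by linarith
    _ = uniformProb T ({u | ¬ IsApproxCount 1 N (countEstimate F x 0 1 4 (u.take ℓ))}ᶜ) := hcompl.symm
    _ ≤ uniformProb T {u : List Bool | boolPair y u ∈ ({w | D w = [true]} : Language Bool) ↔ y ∈ L} :=
        APTransfer.uniformProb_mono_len hcorrect

/-- **The PCP corner.** There is an admissible `(Δ₀, p₀, q₀)` (`Δ₀ ≥ 3`, `q₀ > 0`, `λ_c(Δ₀) < p₀/q₀`; namely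
`(B_SAT + 3, 2^{K_SAT}, 1)` for the gap-E3SAT-`B` presentation of `SAT` given by the tree's proved PCP theorem) at
which an FPRAS for the hard-core count ALONE gives `NP ⊆ BPP` (`SAT ∈ BPP` by `mem_BPP_of_hasFPRAS_corner`, then
NP-hardness of `SAT` and closure of `BPP` under Karp reductions). Fact-free. [cite: Sly2010, §1 (zero-temperature limit)] -/
theorem exists_hardCorner : ∃ Δ p q : ℕ, 3 ≤ Δ ∧ 0 < q ∧ hardCoreThreshold Δ < (p : ℝ) / q ∧
    (HasFPRAS (hardcoreCount Δ p q) → Nondeterministic.NP ⊆ BPP) := by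
  obtain ⟨g, γ, B, hg, hγ, hspec⟩ := stub_gapE3SATB SAT SAT_mem_NP_holds
  obtain ⟨K, hKB, hK6⟩ := exists_K B hγ
  exact ⟨B + 3, 2 ^ K, 1, by omega, Nat.one_pos, ConflictGraphGap.threshold_lt B K hKB, fun hF =>
    NP_subset_BPP_of_isNPHard_of_mem_BPP SAT_isNPHard_holds (mem_BPP_of_hasFPRAS_corner hg hspec hγ hKB hK6 hF)⟩

/-- **The crux is its own instance at the PCP corner (registered sub-goal).** There is an admissible
`(Δ₀, p₀, q₀)` with `NoFBPPApproxAboveUniqueness ↔ ¬ HasFPRAS (hardcoreCount Δ₀ p₀ q₀)`: `⟹` by the calibration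
(`X → NP ⊄ BPP`) and `exists_hardCorner`; `⟸` because a disproof of X is an FPRAS at every admissible point
(`Negative.not_crux_iff`). Fact-free. [folklore] -/
theorem noFBPPApproxAboveUniqueness_iff_not_hasFPRAS_corner :
    ∃ Δ p q : ℕ, 3 ≤ Δ ∧ 0 < q ∧ hardCoreThreshold Δ < (p : ℝ) / q ∧
      (NoFBPPApproxAboveUniqueness ↔ ¬ HasFPRAS (hardcoreCount Δ p q)) := by
  obtain ⟨Δ, p, q, hΔ, hq, hlam, hcorner⟩ := exists_hardCorner
  refine ⟨Δ, p, q, hΔ, hq, hlam, fun hX hF => ?_, fun hno => ?_⟩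
  · exact (noFBPPApproxAboveUniqueness_iff_not_NP_subset_BPP.1 hX) (hcorner hF)
  · by_contra hX
    exact hno (Negative.not_crux_iff.1 hX Δ p q hΔ hq hlam)

end Summit.PneNP.PneNP.Theorems.NoFBPPApproxAboveUniqueness
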